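import Summits.Ventures.PercRepro.ThetaSigmaSepCredit

/-!
# THE SEPARATED (Σ)-INEQUALITY: meets + co-joins ≥ members, for EVERY family; (Σ) at an idle or
full point

Dossier proofs/MINE1-theoremS.md, Addendum 77 (mine-1, gen 40). **Theorem**
(`card_le_sepCount`): for EVERY family `X` of subsets of `U` — no validity hypothesis, `∅` and
`U` allowed, complementary pairs allowed —

  `|X| ≤ |sigmaMeets X| + |sigmaCojoins U X|`  (= `|{∅} ∪ {x ⊓ y : x ≠ y}| + |{U \ (x ⊔ y) : x ≠ y}|`),

and the inequality is STRICT as soon as `|X| ≥ 3` (`card_add_one_le_sepCount`). Proof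
(`card_add_ite_le_sepCount_aux`): the Marica–Schönheim ground-set induction with the induction
hypothesis carrying the strictness. At a point `q ∈ U`: `|X| = |π_q X| + |K|` (the partners
`K`), `sepCount U X ≥ sepCount (U \ q) (π_q X) + (q-edges)`, the `q`-edges pay `K`
(`card_partners_le_card_qEdges`, with the strict inequality for `K` on `U \ q` when `|K| ≥ 3`),
and the induction hypothesis is strict for `π_q X` whenever `|π_q X| ≥ 3`; if `|π_q X| ≤ 2` then
`2|K| ≤ |X| ≤ |K| + 2` forces the square `{x, x + q, y, y + q}`, counted by hand; three members
are counted by hand.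

**Consequence for (Σ)** (`card_le_card_sigmaD_of_idle`, `card_add_one_le_card_sigmaD_of_idle`):
at an **idle point** `p ∈ U` (in no member) every co-join contains `p` and no meet does, so the
two halves are disjoint and `|sigmaD U X| = sepCount U X`: **(Σ) and (Σ⁺) hold unconditionally
for every family with an idle point** — validity is not even needed. By the complement bijection
`x ↦ U \ x` (`sigmaD_complsRel`: the meets of the complements are the co-joins) the same holds
at a **full point** (in every member): `card_le_card_sigmaD_of_full`,
`card_add_one_le_card_sigmaD_of_full`.
-/

namespace PercRepro.MSTight

open Finset

variable {α : Type*} [DecidableEq α]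

section Main

variable {U : Finset α} {X : Finset (Finset α)}

/-- **The separated (Σ)-inequality with its strict form**, by induction on the ground set:
for every family `X` of subsets of `U`, `|X| + [|X| ≥ 3] ≤ |sigmaMeets X| + |sigmaCojoins U X|`. -/
theorem card_add_ite_le_sepCount_aux (n : ℕ) :
    ∀ U : Finset α, U.card = n → ∀ X : Finset (Finset α), (∀ x ∈ X, x ⊆ U) →
      X.card + (if 3 ≤ X.card then 1 else 0) ≤ sepCount U X := by
  induction n with
  | zero =>
    intro U hU X hX
    rw [card_eq_zero] at hU
    subst hU
    have h1 : X.card ≤ 1 := by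
      rw [card_le_one]
      intro a ha b hb
      rw [subset_empty.1 (hX a ha), subset_empty.1 (hX b hb)]
    have h2 := one_le_card_sigmaMeets X
    have h3 : ¬ 3 ≤ X.card := by omega
    unfold sepCount
    rw [if_neg h3]
    omega
  | succ n ih =>
    intro U hU X hX
    have hM := one_le_card_sigmaMeets X
    rcases Nat.lt_or_ge X.card 2 with h1 | h2
    · have h3 : ¬ 3 ≤ X.card := by omega
      unfold sepCount
      rw [if_neg h3]
      omega
    rcases Nat.lt_or_ge X.card 3 with h2' | h3
    · -- two members
      have hc : X.card = 2 := by omega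
      obtain ⟨x, y, hxy, hXxy⟩ := card_eq_two.1 hc
      have hx : x ∈ X := by rw [hXxy]; simp
      have hy : y ∈ X := by rw [hXxy]; simp
      have hC := card_pos.2 ⟨_, sdiff_sup_mem_sigmaCojoins (U := U) hxy hx hy⟩
      have h3 : ¬ 3 ≤ X.card := by omega
      unfold sepCount
      rw [if_neg h3]
      omega
    rw [if_pos h3]
    rcases Nat.lt_or_ge X.card 4 with h3' | h4
    · -- three members
      have hc : X.card = 3 := by omega
      obtain ⟨x, y, z, hxy, hxz, hyz, hXxyz⟩ := card_eq_three.1 hc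
      have hx : x ∈ X := by rw [hXxyz]; simp
      have hy : y ∈ X := by rw [hXxyz]; simp
      have hz : z ∈ X := by rw [hXxyz]; simp
      have := four_le_sepCount_of_three (hX x hx) (hX y hy) (hX z hz) hxy hxz hyz
      rw [← hXxyz] at this
      omega
    -- four or more members: project at a point `q ∈ U`
    have hUne : U.Nonempty := by
      rw [← card_pos]
      omega
    obtain ⟨q, hqU⟩ := hUne
    have hU' : (U.erase q).card = n := by
      rw [card_erase_of_mem hqU, hU]
      rfl
    have ih' := ih (U.erase q) hU'
    have hproj := card_image_erase_add_card_partners q X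
    have hlift := sepCount_image_erase_add_le q U X
    have hcredit := card_partners_le_card_qEdges hqU h4 ih' hX
    rcases Nat.lt_or_ge (X.card) ((partners q X).card + 3) with hsmall | hbig
    · -- the square: `2|K| ≤ |X| ≤ |K| + 2` forces `|X| = 4`, `|K| = 2`
      have h2K := two_mul_card_partners_le q X
      have hK2 : (partners q X).card = 2 := by omega
      have hX4 : X.card = 4 := by omega
      obtain ⟨x, y, hxy, hKxy⟩ := card_eq_two.1 hK2
      have hx : x ∈ partners q X := by rw [hKxy]; simp
      have hy : y ∈ partners q X := by rw [hKxy]; simp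
      have hx' := mem_partners.1 hx
      have hy' := mem_partners.1 hy
      have hsub : ({x, insert q x, y, insert q y} : Finset (Finset α)) ⊆ X := by
        intro z hz
        simp only [mem_insert, mem_singleton] at hz
        rcases hz with rfl | rfl | rfl | rfl
        · exact hx'.1
        · exact hx'.2.2
        · exact hy'.1
        · exact hy'.2.2
      have hXeq : ({x, insert q x, y, insert q y} : Finset (Finset α)) = X := by
        apply eq_of_subset_of_card_le hsub
        have := card_le_card hsub
        have h5 := five_le_sepCount_square hqU (hX x hx'.1) (hX y hy'.1) hx'.2.1 hy'.2.1 hxy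
        -- `|{x, x+q, y, y+q}| = 4`: the four sets are distinct
        have hxx' : x ≠ insert q x := fun h => hx'.2.1 (h ▸ mem_insert_self q x)
        have hyy' : y ≠ insert q y := fun h => hy'.2.1 (h ▸ mem_insert_self q y)
        have hx'y' := insert_ne_insert_of_partners hx hy hxy
        have hxy' : x ≠ insert q y := fun h => hx'.2.1 (h ▸ mem_insert_self q y)
        have hx'y : insert q x ≠ y := fun h => hy'.2.1 (h ▸ mem_insert_self q x)
        rw [card_insert_of_notMem, card_insert_of_notMem, card_pair hyy']
        · omega
        · simp only [mem_insert, mem_singleton, not_or]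
          exact ⟨hx'y, hx'y'⟩
        · simp only [mem_insert, mem_singleton, not_or]
          exact ⟨hxx', hxy, hxy'⟩
      have h5 := five_le_sepCount_square hqU (hX x hx'.1) (hX y hy'.1) hx'.2.1 hy'.2.1 hxy
      rw [hXeq] at h5
      omega
    · -- the induction proper: the projection has at least three members
      have hX' : ∀ x ∈ X.image (fun x => x.erase q), x ⊆ U.erase q := by
        intro x hx
        obtain ⟨y, hy, rfl⟩ := mem_image.1 hx
        exact erase_subset_erase q (hX y hy)
      have hih := ih' (X.image fun x => x.erase q) hX'
      have h3' : 3 ≤ (X.image fun x => x.erase q).card := by omega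
      rw [if_pos h3'] at hih
      omega

/-- **The separated (Σ)-inequality**: for EVERY family `X` of subsets of `U`,
`|X| ≤ |sigmaMeets X| + |sigmaCojoins U X|`. -/
theorem card_le_sepCount (U : Finset α) (X : Finset (Finset α)) (hX : ∀ x ∈ X, x ⊆ U) :
    X.card ≤ sepCount U X := by
  have := card_add_ite_le_sepCount_aux U.card U rfl X hX
  omega

/-- **The strict separated (Σ)-inequality**: with at least three members,
`|X| + 1 ≤ |sigmaMeets X| + |sigmaCojoins U X|`. -/
theorem card_add_one_le_sepCount (U : Finset α) (X : Finset (Finset α)) (hX : ∀ x ∈ X, x ⊆ U)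
    (h3 : 3 ≤ X.card) : X.card + 1 ≤ sepCount U X := by
  have := card_add_ite_le_sepCount_aux U.card U rfl X hX
  rwa [if_pos h3] at this

end Main

section IdleFull

variable {U : Finset α} {X : Finset (Finset α)} {p : α}

/-- At an **idle point** `p` (in `U`, in no member) the two halves are disjoint: every co-join
contains `p`, no meet does. -/
theorem disjoint_sigmaMeets_sigmaCojoins_of_idle (hp : p ∈ U) (hidle : ∀ x ∈ X, p ∉ x) :
    Disjoint (sigmaMeets X) (sigmaCojoins U X) := by
  rw [disjoint_left]
  intro E hE hE'
  obtain ⟨x, hx, y, hy, -, rfl⟩ := mem_sigmaCojoins.1 hE'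
  have hpE : p ∈ U \ (x ⊔ y) := by
    rw [mem_sdiff, sup_eq_union, mem_union, not_or]
    exact ⟨hp, hidle x hx, hidle y hy⟩
  rcases mem_sigmaMeets.1 hE with h | ⟨z, hz, w, -, -, h⟩
  · rw [h] at hpE
    exact absurd hpE (notMem_empty p)
  · rw [← h, inf_eq_inter, mem_inter] at hpE
    exact hidle z hz hpE.1

/-- At an idle point, `|sigmaD U X|` is the separated count. -/
theorem card_sigmaD_eq_sepCount_of_idle (hp : p ∈ U) (hidle : ∀ x ∈ X, p ∉ x) :
    (sigmaD U X).card = sepCount U X := by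
  rw [sigmaD_eq_sigmaMeets_union_sigmaCojoins,
    card_union_of_disjoint (disjoint_sigmaMeets_sigmaCojoins_of_idle hp hidle)]
  rfl

/-- **(Σ) at an idle point, unconditionally**: if some point of `U` lies in no member of `X`,
then `|X| ≤ |sigmaD U X|` — no validity needed. -/
theorem card_le_card_sigmaD_of_idle (hX : ∀ x ∈ X, x ⊆ U) (hp : p ∈ U)
    (hidle : ∀ x ∈ X, p ∉ x) : X.card ≤ (sigmaD U X).card := by
  rw [card_sigmaD_eq_sepCount_of_idle hp hidle]
  exact card_le_sepCount U X hX

/-- **(Σ⁺) at an idle point**: with at least three members the inequality is strict. -/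
theorem card_add_one_le_card_sigmaD_of_idle (hX : ∀ x ∈ X, x ⊆ U) (hp : p ∈ U)
    (hidle : ∀ x ∈ X, p ∉ x) (h3 : 3 ≤ X.card) : X.card + 1 ≤ (sigmaD U X).card := by
  rw [card_sigmaD_eq_sepCount_of_idle hp hidle]
  exact card_add_one_le_sepCount U X hX h3

/-- The (Σ)-difference family is invariant under relative complementation of the members:
the meets of the complements are the co-joins and conversely. -/
theorem sigmaD_complsRel (hX : ∀ x ∈ X, x ⊆ U) : sigmaD U (complsRel U X) = sigmaD U X := by
  have key1 : ∀ x y : Finset α, (U \ x) ⊓ (U \ y) = U \ (x ⊔ y) := by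
    intro x y
    ext a
    simp only [inf_eq_inter, mem_inter, mem_sdiff, sup_eq_union, mem_union]
    tauto
  have key2 : ∀ x ∈ X, ∀ y ∈ X, U \ ((U \ x) ⊔ (U \ y)) = x ⊓ y := by
    intro x hx y hy
    ext a
    have hxa := hX x hx
    simp only [inf_eq_inter, mem_inter, mem_sdiff, sup_eq_union, mem_union, not_or, not_and,
      not_not]
    constructor
    · rintro ⟨hU, h1, h2⟩
      exact ⟨h1 hU, h2 hU⟩
    · rintro ⟨h1, h2⟩
      exact ⟨hxa h1, fun _ => h1, fun _ => h2⟩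
  have hne : ∀ x ∈ X, ∀ y ∈ X, (U \ x ≠ U \ y ↔ x ≠ y) := by
    intro x hx y hy
    constructor
    · intro h h'
      exact h (h' ▸ rfl)
    · intro h h'
      apply h
      rw [← Finset.sdiff_sdiff_eq_self (hX x hx), h', Finset.sdiff_sdiff_eq_self (hX y hy)]
  ext E
  rw [mem_sigmaD, mem_sigmaD]
  constructor
  · rintro (h | ⟨x', hx', y', hy', hne', rfl⟩ | ⟨x', hx', y', hy', hne', rfl⟩)
    · exact Or.inl h
    · obtain ⟨x, hx, rfl⟩ := mem_complsRel.1 hx'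
      obtain ⟨y, hy, rfl⟩ := mem_complsRel.1 hy'
      exact Or.inr (Or.inr ⟨x, hx, y, hy, (hne x hx y hy).1 hne', (key1 x y).symm⟩)
    · obtain ⟨x, hx, rfl⟩ := mem_complsRel.1 hx'
      obtain ⟨y, hy, rfl⟩ := mem_complsRel.1 hy'
      exact Or.inr (Or.inl ⟨x, hx, y, hy, (hne x hx y hy).1 hne', (key2 x hx y hy).symm⟩)
  · rintro (h | ⟨x, hx, y, hy, hxy, rfl⟩ | ⟨x, hx, y, hy, hxy, rfl⟩)
    · exact Or.inl h
    · exact Or.inr (Or.inr ⟨U \ x, mem_complsRel.2 ⟨x, hx, rfl⟩, U \ y,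
        mem_complsRel.2 ⟨y, hy, rfl⟩, (hne x hx y hy).2 hxy, key2 x hx y hy⟩)
    · exact Or.inr (Or.inl ⟨U \ x, mem_complsRel.2 ⟨x, hx, rfl⟩, U \ y,
        mem_complsRel.2 ⟨y, hy, rfl⟩, (hne x hx y hy).2 hxy, key1 x y⟩)

/-- Relative complementation preserves the number of members. -/
theorem card_complsRel_of_subset (hX : ∀ x ∈ X, x ⊆ U) : (complsRel U X).card = X.card := by
  unfold complsRel
  apply card_image_of_injOn
  intro x hx y hy hxy
  have hxy' : U \ x = U \ y := hxy
  rw [← Finset.sdiff_sdiff_eq_self (hX x hx), hxy', Finset.sdiff_sdiff_eq_self (hX y hy)]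

/-- **(Σ) at a full point, unconditionally**: if some point of `U` lies in every member of `X`,
then `|X| ≤ |sigmaD U X|` (by the complement bijection, which makes the point idle). -/
theorem card_le_card_sigmaD_of_full (hX : ∀ x ∈ X, x ⊆ U) (hp : p ∈ U)
    (hfull : ∀ x ∈ X, p ∈ x) : X.card ≤ (sigmaD U X).card := by
  have hX' : ∀ x ∈ complsRel U X, x ⊆ U := by
    intro x hx
    obtain ⟨y, -, rfl⟩ := mem_complsRel.1 hx
    exact sdiff_subset
  have hidle : ∀ x ∈ complsRel U X, p ∉ x := by
    intro x hx
    obtain ⟨y, hy, rfl⟩ := mem_complsRel.1 hx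
    rw [mem_sdiff, not_and, not_not]
    exact fun _ => hfull y hy
  rw [← card_complsRel_of_subset hX, ← sigmaD_complsRel hX]
  exact card_le_card_sigmaD_of_idle hX' hp hidle

/-- **(Σ⁺) at a full point**: with at least three members the inequality is strict. -/
theorem card_add_one_le_card_sigmaD_of_full (hX : ∀ x ∈ X, x ⊆ U) (hp : p ∈ U)
    (hfull : ∀ x ∈ X, p ∈ x) (h3 : 3 ≤ X.card) : X.card + 1 ≤ (sigmaD U X).card := by
  have hX' : ∀ x ∈ complsRel U X, x ⊆ U := by
    intro x hx
    obtain ⟨y, -, rfl⟩ := mem_complsRel.1 hx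
    exact sdiff_subset
  have hidle : ∀ x ∈ complsRel U X, p ∉ x := by
    intro x hx
    obtain ⟨y, hy, rfl⟩ := mem_complsRel.1 hx
    rw [mem_sdiff, not_and, not_not]
    exact fun _ => hfull y hy
  rw [← card_complsRel_of_subset hX, ← sigmaD_complsRel hX]
  exact card_add_one_le_card_sigmaD_of_idle hX' hp hidle (by rwa [card_complsRel_of_subset hX])

end IdleFull

end PercRepro.MSTight
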